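import Summits.QuantumAdvantage.AdviceFreeQNC0.ProductGameSmallBlocks
import Summits.QuantumAdvantage.AdviceFreeQNC0.LDMATransfer
import Summits.QuantumAdvantage.AdviceFreeQNC0.WindowDegree
import Summits.QuantumAdvantage.AdviceFreeQNC0.AugmentedCodePatterns
import Literature.Computability.MetaComplexity.LowDegreeClosure
import HarnessLib

/-!
# Cell qa-qnc0 (rung F-Q1, route RingFrame, crux α): the induced strategy on Bob's cube and its
# atoms (planner qa-qnc0-p1 ROUND-9 §6b, THEOREM-TARGET T7 "Theorem V", ask P10 — ingredients)

In the GENUINE product game of a walk strategy `y` on `n = L + L'` bits, team 1's column profile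
`F1 y v u` depends on Alice's input `u` only through the INDUCED STRATEGY
`induced y u = (v ↦ y_{L+g'}(u ++ v))_{g' ≤ L'}` — a tuple of `L'+1` functions of degree `≤ D` on
Bob's cube (`F1_eq_of_induced_eq`, = Sketch10 `F1FactorsThroughInduced`).  A function of degree
`≤ D` is determined by its values on the Hamming ball of radius `D` (`eq_of_hasDeg_of_ball`, =
Sketch10 `EvalBallInjective`, from the tree's `eq_zero_of_forall_wt_le`), so the ATOMS
`{u : induced y u = s}` of Alice's cube have indicators of degree `≤ D·(L'+1)·#Ball(L', D)`
(`hasDeg_induced_atom`, = Sketch10 `AtomDegInduced`) — POLYNOMIAL in `L'`, against the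
`2^{L'}·D` of the abstract row map (`atom_mem_lowDeg`).  Finally `ldma_of_pldams_fibres`: PLDAMS at
the atom degree gives weighted residue non-avoidance for every weight that is constant on the fibres
of an arbitrary map `Ψ` (= `ldma_of_pldams_atoms` for a general index, Sketch10 `ldma_of_pldams_atoms'`).

WHAT THIS IS NOT: the assembly (`walkHard_logOverLogLog`) is in `WalkHardLogOverLogLog.lean`;
nothing here at polylog degree; α untouched.
-/

noncomputable section

namespace Summit.QuantumAdvantage.AdviceFreeQNC0

open Finset
open Literature.Computability.MetaComplexity Literature.Computability.MetaComplexity.Smolensky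

variable {L L' : ℕ}

/-! ### The induced strategy -/

/-- The strategy induced on Bob's cube by Alice's input `u`: position `L + g'` read at `u ++ v`. -/
def induced (y : Fin (L + L' + 1) → (Fin (L + L') → Bool) → Bool) (u : Fin L → Bool) :
    Fin (L' + 1) → (Fin L' → Bool) → Bool :=
  fun g' v => y ⟨L + g'.val, by omega⟩ (Fin.append u v)

/-- **Team 1's profile factors through the induced strategy** (Sketch10 `F1FactorsThroughInduced`). -/
theorem F1_eq_of_induced_eq (y : Fin (L + L' + 1) → (Fin (L + L') → Bool) → Bool)
    {u u' : Fin L → Bool} (h : induced y u = induced y u') (v : Fin L' → Bool) :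
    F1 y v u = F1 y v u' := by
  unfold F1
  refine t4sum_congr _ fun g hg => ?_
  have hgL : L ≤ g.val := not_lt.1 (Finset.mem_filter.1 hg).2
  have hg' : g.val - L < L' + 1 := by have := g.isLt; omega
  have e : g = ⟨L + (g.val - L), by omega⟩ := Fin.ext (by simp; omega)
  have hy : y g (Fin.append u v) = y g (Fin.append u' v) := by
    have := congrFun (congrFun h ⟨g.val - L, hg'⟩) v
    unfold induced at this
    rw [e]; exact this
  rw [hy]

/-- The components of the induced strategy have degree `≤ D` on Bob's cube. -/
theorem hasDeg_induced {D : ℕ} (y : Fin (L + L' + 1) → (Fin (L + L') → Bool) → Bool)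
    (hy : ∀ g, HasDeg (y g) D) (u : Fin L → Bool) (g' : Fin (L' + 1)) : HasDeg (induced y u g') D :=
  hasDeg_append_right u (hy _)

/-! ### Evaluation on the Hamming ball is injective on low-degree functions -/

/-- **Sketch10 `EvalBallInjective`**: two functions of degree `≤ D` that agree on the Hamming ball of
radius `D` are equal. -/
theorem eq_of_hasDeg_of_ball {m D : ℕ} {f g : (Fin m → Bool) → Bool} (hf : HasDeg f D)
    (hg : HasDeg g D) (h : ∀ v : Fin m → Bool, wt v ≤ D → f v = g v) : f = g := by
  unfold HasDeg at hf hg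
  have hR : (fun v => (if f v = true then (1 : ZMod 2) else 0) - (if g v = true then (1 : ZMod 2) else 0)) ∈
      lowDeg (ZMod 2) m D := Submodule.sub_mem _ hf hg
  have h0 := eq_zero_of_forall_wt_le hR (fun a ha => by
    have := h a ha
    simp only [this, sub_self])
  funext v
  have hv := congrFun h0 v
  simp only [Pi.zero_apply, sub_eq_zero] at hv
  revert hv
  cases f v <;> cases g v <;> simp

/-! ### Conjunctions of low-degree conditions -/

/-- A conjunction of `#F` conditions of degree `≤ d` has degree `≤ d·#F` (stated for any Boolean
function `G` with the conjunction as its specification, to stay clear of decidability instances). -/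
theorem hasDeg_forall_deg {m : ℕ} {ι : Type*} [DecidableEq ι] (F : Finset ι)
    (g : ι → (Fin m → Bool) → Bool) (d : ℕ) (hg : ∀ j ∈ F, HasDeg (g j) d)
    {G : (Fin m → Bool) → Bool} (hG : ∀ u, G u = true ↔ ∀ j ∈ F, g j u = true) :
    HasDeg G (d * F.card) := by
  induction F using Finset.induction_on generalizing G with
  | empty =>
    have h : G = fun _ => true := by
      funext u; exact (hG u).2 (by simp)
    rw [h, Finset.card_empty, mul_zero]; exact hasDeg_const true 0
  | insert a F ha ih =>
    classical
    have hG' := ih (fun j hj => hg j (Finset.mem_insert_of_mem hj))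
      (G := fun u => decide (∀ j ∈ F, g j u = true)) (fun u => by rw [decide_eq_true_eq])
    have h : G = fun u => g a u && decide (∀ j ∈ F, g j u = true) := by
      funext u
      rw [Bool.eq_iff_iff, hG u, Bool.and_eq_true, decide_eq_true_eq, Finset.forall_mem_insert]
    rw [h, Finset.card_insert_of_notMem ha, Nat.mul_succ, add_comm]
    exact hasDeg_and (hg a (Finset.mem_insert_self a F)) hG'

/-- `[f u = b]` has the degree of `f`. -/
theorem hasDeg_decide_eq {m d : ℕ} {f : (Fin m → Bool) → Bool} (hf : HasDeg f d) (b : Bool) :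
    HasDeg (fun u => decide (f u = b)) d := by
  cases b
  · have e : (fun u => decide (f u = false)) = fun u => !f u := by funext u; cases f u <;> rfl
    rw [e]; exact hasDeg_not hf
  · have e : (fun u => decide (f u = true)) = f := by funext u; cases f u <;> rfl
    rw [e]; exact hf

/-! ### The atoms of the induced strategy -/

variable (L' : ℕ) in
/-- The Hamming ball of radius `D` in Bob's cube. -/
def ball (D : ℕ) : Finset (Fin L' → Bool) := univ.filter fun v : Fin L' → Bool => wt v ≤ D

/-- **Sketch10 `AtomDegInduced`**: the atoms of the induced-strategy map have degree
`≤ D·(L'+1)·#Ball(L',D)`. -/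
theorem hasDeg_induced_atom {D : ℕ} (y : Fin (L + L' + 1) → (Fin (L + L') → Bool) → Bool)
    (hy : ∀ g, HasDeg (y g) D) (s : Fin (L' + 1) → (Fin L' → Bool) → Bool) :
    HasDeg (fun u : Fin L → Bool => decide (induced y u = s)) (D * ((L' + 1) * (ball L' D).card)) := by
  classical
  by_cases hs : ∀ g', HasDeg (s g') D
  · -- the atom is cut out by the ball test
    refine hasDeg_of_le (hasDeg_forall_deg ((univ : Finset (Fin (L' + 1))) ×ˢ ball L' D)
      (fun p (u : Fin L → Bool) => decide (y ⟨L + p.1.val, by omega⟩ (Fin.append u p.2) = s p.1 p.2)) D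
      (fun p _ => hasDeg_decide_eq (hasDeg_append_left p.2 (hy _)) _) (fun u => ?_)) (le_of_eq ?_)
    · rw [decide_eq_true_eq]
      simp only [Finset.mem_product, Finset.mem_univ, true_and, decide_eq_true_eq, ball,
        Finset.mem_filter]
      constructor
      · rintro h ⟨g', v⟩ _
        exact congrFun (congrFun h g') v
      · intro h
        funext g'
        exact eq_of_hasDeg_of_ball (hasDeg_induced y hy u g') (hs g') fun v hv => h (g', v) hv
    · rw [Finset.card_product, Finset.card_univ, Fintype.card_fin]
  · -- no induced strategy has a component of degree `> D`: the atom is empty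
    push Not at hs
    obtain ⟨g', hg'⟩ := hs
    have e : (fun u : Fin L → Bool => decide (induced y u = s)) = fun _ => false := by
      funext u
      rw [decide_eq_false_iff_not]
      intro h
      have h' := hasDeg_induced y hy u g'
      rw [h] at h'
      exact hg' h'
    rw [e]; exact hasDeg_false _

/-! ### PLDAMS on fibres gives weighted residue non-avoidance -/

/-- **Sketch10 `ldma_of_pldams_atoms'`** (general index): if every fibre of a map `Ψ` on Alice's cube
has an indicator of degree `≤ dA`, PLDAMS holds at degree `dA`, and the weight `w` is constant on the
fibres of `Ψ`, then every residue class carries a `κ`-fraction of `Σ_u w u`. -/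
theorem ldma_of_pldams_fibres {κ : ℝ} {dA : ℕ} {Z : Type*} [DecidableEq Z]
    (hP : ∀ g : CubeFn (ZMod 2) L, g ∈ lowDeg (ZMod 2) L dA → ∀ r : ℕ,
      κ * ((univ.filter fun u : Fin L → Bool => g u ≠ 0).card : ℝ) ≤
        ((univ.filter fun u : Fin L → Bool => g u ≠ 0 ∧ wt u % 3 = r % 3).card : ℝ))
    (Ψ : (Fin L → Bool) → Z) (hΨ : ∀ z, HasDeg (fun u => decide (Ψ u = z)) dA)
    (w : (Fin L → Bool) → ℕ) (hw : ∀ u u', Ψ u = Ψ u' → w u = w u') (r : ℕ) :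
    κ * ((∑ u : Fin L → Bool, w u : ℕ) : ℝ) ≤
      ((∑ u ∈ univ.filter (fun u : Fin L → Bool => wt u % 3 = r % 3), w u : ℕ) : ℝ) := by
  classical
  set T := (univ : Finset (Fin L → Bool)).image Ψ with hT
  -- fibre decomposition of both sums along `Ψ`
  have hLsum : (∑ u : Fin L → Bool, (w u : ℝ)) =
      ∑ z ∈ T, ∑ u ∈ univ.filter (fun u : Fin L → Bool => Ψ u = z), (w u : ℝ) :=
    (Finset.sum_fiberwise_of_maps_to (fun u hu => Finset.mem_image_of_mem Ψ hu) _).symm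
  have hRsum : (∑ u ∈ univ.filter (fun u : Fin L → Bool => wt u % 3 = r % 3), (w u : ℝ)) =
      ∑ z ∈ T, ∑ u ∈ (univ.filter fun u : Fin L → Bool => wt u % 3 = r % 3).filter
        (fun u => Ψ u = z), (w u : ℝ) :=
    (Finset.sum_fiberwise_of_maps_to (fun u _ => Finset.mem_image_of_mem Ψ (Finset.mem_univ u)) _).symm
  push_cast
  rw [hLsum, hRsum, Finset.mul_sum]
  refine Finset.sum_le_sum fun z hz => ?_
  -- a representative of the fibre
  obtain ⟨u₀, -, hu₀⟩ := Finset.mem_image.1 hz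
  have hconst : ∀ u ∈ univ.filter (fun u : Fin L → Bool => Ψ u = z), (w u : ℝ) = w u₀ := by
    intro u hu
    rw [hw u u₀ ((Finset.mem_filter.1 hu).2.trans hu₀.symm)]
  have hconst' : ∀ u ∈ (univ.filter fun u : Fin L → Bool => wt u % 3 = r % 3).filter (fun u => Ψ u = z),
      (w u : ℝ) = w u₀ := by
    intro u hu
    rw [hw u u₀ ((Finset.mem_filter.1 hu).2.trans hu₀.symm)]
  rw [Finset.sum_congr rfl hconst, Finset.sum_congr rfl hconst', Finset.sum_const, Finset.sum_const,
    nsmul_eq_mul, nsmul_eq_mul]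
  -- PLDAMS on the fibre
  have hg := hΨ z
  unfold HasDeg at hg
  have hatom := hP _ hg r
  have h1 : (univ.filter fun u : Fin L → Bool =>
      (if decide (Ψ u = z) = true then (1 : ZMod 2) else 0) ≠ 0) =
      univ.filter fun u : Fin L → Bool => Ψ u = z := by
    ext u; simp only [mem_filter, mem_univ, true_and]; by_cases h : Ψ u = z <;> simp [h]
  have h2 : (univ.filter fun u : Fin L → Bool =>
      (if decide (Ψ u = z) = true then (1 : ZMod 2) else 0) ≠ 0 ∧ wt u % 3 = r % 3) =
      (univ.filter fun u : Fin L → Bool => wt u % 3 = r % 3).filter fun u => Ψ u = z := by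
    ext u; simp only [mem_filter, mem_univ, true_and]; by_cases h : Ψ u = z <;> simp [h]
  rw [h1, h2] at hatom
  have hw0 : (0 : ℝ) ≤ w u₀ := Nat.cast_nonneg _
  calc κ * (((univ.filter fun u : Fin L → Bool => Ψ u = z).card : ℝ) * (w u₀ : ℝ))
      = (κ * ((univ.filter fun u : Fin L → Bool => Ψ u = z).card : ℝ)) * (w u₀ : ℝ) := by ring
    _ ≤ ((((univ.filter fun u : Fin L → Bool => wt u % 3 = r % 3).filter
          fun u => Ψ u = z).card : ℝ)) * (w u₀ : ℝ) := mul_le_mul_of_nonneg_right hatom hw0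

end Summit.QuantumAdvantage.AdviceFreeQNC0

end
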